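import Summits.CriticalPhenomena.PercolationContinuityZ3.Theorems.PercNearOneGluingNoHeavyQuantFarTreeRowContraction
import Summits.CriticalPhenomena.PercolationContinuityZ3.Theorems.PercNearOneGluingNoHeavyQuantFarRelayRowStar
import Summits.CriticalPhenomena.PercolationContinuityZ3.Theorems.PercNearOneGluingNoHeavyQuantFarTreeHubBlocks
import Literature.Probability.LatticeModels.ProdBernoulliBlocks
import HarnessLib

/-!
# QUANT lane R8, FAR on trees: the far-relay row at EVERY layer for BLOCK-COMBS in the bare-leaf cell
# (root blocks + a chain with glued blocks hanging off it at any levels, read from a distinguished relay whose own gate is the least private gate)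

builds on p205010 (kernel theorem, internal audit signed; external expert review pending)

Support file (`--supports stmt-CriticalPhenomena-4575`), QUANT lane seat prim-quant-p1 (gen 7); memo `run/shared/lean/prim/quant/P1-SURPLUS.md`
§18; rung R8 of `run/shared/lean/prim/quant/LADDER.md`.  Theorems only; no definitions, no sorries, standard axioms.  Vocabulary of
`Quant.FarTreeRow` (`…QuantFarTreeRow.lean`): gate sets `P x` on `Fin m`, independent gates `prodBernoulli q`, a relay `b` reached iff `P b` is open,
light event `{ω | #{b ∈ A | ↑(P b) ⊆ ω} ≤ j}`.

**Family (block-combs read from a distinguished relay `a`).**  Relays `b` with `a ∈ P b` are GLUED to `a` (extra gates sure); every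
other relay has a PRIVATE part `P b ∖ P a`, and two private parts are EQUAL (a glued block) or DISJOINT.  Contains block-stars (`P a = {a}`),
combs, 'hub + leaves + root blocks' (`Quant.farTree_hubBlock(s)`), root blocks + combs of any depth, blob hairs at any level of the chain
(LEAD-NOTES-G9 N20 (b)), spine relays.  Only `x ∈ P x` is used — the chain enters through the cell condition:
**bare-leaf cell** `q a ≤ ∏_{y ∈ P b ∖ P a} q y` for every `b` with `a ∉ P b` (the distinguished relay's OWN gate is at most every private reach
probability); it makes `a` least likely and keeps it so when strict ancestors of `a` are contracted.  For hub + leaves + root blocks this is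
stmt g11's cell 'blocks heavier than the bare leaf'; the complementary light-block cell is the open [MTL] residue (`Quant.HubBlocksProfileIneq`).
* `Quant.farTree_blockComb_bareLeaf_base` — chain above `a` sure: the light event is read through independent BLOCKS
  (`prodBernoulli_real_preimage_readBlocks`), whose least parameter is `q a` and weighted mean `≥ Σ_b T b > 2j`, and
  `Quant.IndepBlob.prodBernoulli_far_indepBlob` (lead g5) bounds it by `1 − q a`; sure gates forced open by `prodBernoulli_real_eq_union_of_gate_one`.
* `Quant.farTree_blockComb_bareLeaf_aux` — induction on the non-sure strict ancestors of `a` via `Quant.farTree_light_le_of_contract` (stmt g10).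
* `Quant.farTree_blockComb_bareLeaf` — **FAR at EVERY layer for block-combs in the bare-leaf cell: `2j < Σ_{b∈A} T b`, `1 − T a ≤ t` ⟹
  `P(#{b ∈ A | P b open} ≤ j) ≤ t`.**  Honest scope: a CELL result; outside it a contraction makes a light competitor the argmin (= [MTL]'s hard cell).
Numerics behind the statement (exact, `prim-quant-p1-g7/evidence/`): the lossy sojourn reduction (BSS) is false, endpoint relocation gets stuck
next to root blocks even on minimal configurations, the tied vertex (BSS-mono) is clean (514 425 / 0).
[cite: KozmaNitzan2024, Lemma 2 (p. 6), Conjecture 3 (p. 15)] (the gluing rows `Quant.FarTreeRow` serves); the family theorem is [this work].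
-/

noncomputable section

namespace Summit.CriticalPhenomena.PercolationContinuityZ3.Theorems

namespace Quant

open Finset MeasureTheory
open Literature.Probability.LatticeModels
open Literature.Probability.Percolation
open scoped Classical

variable {m : ℕ}

/-- **Base case: the chain above `a` is sure.**  With every strict member of `P a` of gate `1`, glued relays below `a`, private parts pairwise
equal or disjoint and the bare-leaf condition, `2j < Σ_b ∏_{P b} q` implies `P(#{b ∈ A | P b open} ≤ j) ≤ 1 − q a` (independent blocks +
`Quant.IndepBlob.prodBernoulli_far_indepBlob`). [this work] -/
theorem farTree_blockComb_bareLeaf_base (P : Fin m → Finset (Fin m)) (hrefl : ∀ x, x ∈ P x)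
    (q : Fin m → unitInterval) (A : Finset (Fin m)) (j : ℕ) (a : Fin m) (haA : a ∈ A)
    (hchain : ∀ y ∈ P a, y ≠ a → q y = 1)
    (hglue : ∀ b ∈ A, a ∈ P b → ∀ y ∈ P b, y ∉ P a → q y = 1)
    (hshape : ∀ b ∈ A, ∀ b' ∈ A, a ∉ P b → a ∉ P b' →
      P b \ P a = P b' \ P a ∨ Disjoint (P b \ P a) (P b' \ P a))
    (hbare : ∀ b ∈ A, a ∉ P b → (q a : ℝ) ≤ ∏ y ∈ P b \ P a, (q y : ℝ))
    (hEN : (2 * j : ℝ) < ∑ b ∈ A, ∏ y ∈ P b, (q y : ℝ)) :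
    (prodBernoulli q).real
        {ω : Set (Fin m) | (A.filter fun b => ((P b : Finset (Fin m)) : Set (Fin m)) ⊆ ω).card ≤ j} ≤ 1 - (q a : ℝ) := by
  set μ := prodBernoulli q with hμ
  have hq0 : ∀ y, (0 : ℝ) ≤ q y := fun y => (q y).2.1; have hq1 : ∀ y, (q y : ℝ) ≤ 1 := fun y => (q y).2.2
  set L : Set (Set (Fin m)) :=
    {ω : Set (Fin m) | (A.filter fun b => ((P b : Finset (Fin m)) : Set (Fin m)) ⊆ ω).card ≤ j} with hL
  set G : Fin m → Finset (Fin m) := fun b => P b \ P a with hG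
  have haG : ∀ b, a ∉ G b := fun b h => (Finset.mem_sdiff.1 h).2 (hrefl a)
  set T : Finset (Fin m) := (P a).erase a ∪ (A.filter fun b => a ∈ P b).biUnion G with hT
  have hT1 : ∀ y ∈ T, q y = 1 := by
    intro y hy
    rcases Finset.mem_union.1 hy with hy | hy
    · exact hchain y (Finset.mem_of_mem_erase hy) (Finset.ne_of_mem_erase hy)
    · obtain ⟨b, hb, hyb⟩ := Finset.mem_biUnion.1 hy
      rw [Finset.mem_filter] at hb
      exact hglue b hb.1 hb.2 y (Finset.mem_sdiff.1 hyb).1 (Finset.mem_sdiff.1 hyb).2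
  set blk : Fin m → Fin m := fun y =>
    if h : ∃ b, b ∈ A ∧ a ∉ P b ∧ y ∈ G b then (G (Classical.choose h)).min' ⟨y, (Classical.choose_spec h).2.2⟩ else y
    with hblk
  set rel : Fin m → Prop := fun y => y = a ∨ ∃ b, b ∈ A ∧ a ∉ P b ∧ y ∈ G b with hrel
  set g : Fin m → Set (Fin m) → Prop := fun k ω => ∀ e, blk e = k → rel e → e ∈ ω with hg
  have hnot_a : ¬ ∃ b, b ∈ A ∧ a ∉ P b ∧ a ∈ G b := fun ⟨b, _, _, h⟩ => haG b h
  have hblk_a : blk a = a := by simp only [hblk, dif_neg hnot_a]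
  have hclass : ∀ b ∈ A, ∀ b' ∈ A, a ∉ P b → a ∉ P b' → ∀ y, y ∈ G b → y ∈ G b' → G b = G b' := by
    intro b hb b' hb' hab hab' y hy hy'
    rcases hshape b hb b' hb' hab hab' with h | h
    · exact h
    · exact absurd (Finset.disjoint_left.1 h hy) (not_not.2 hy')
  have hblk_G : ∀ b ∈ A, a ∉ P b → ∀ y (hy : y ∈ G b), blk y = (G b).min' ⟨y, hy⟩ := by
    intro b hb hab y hy
    have hex : ∃ b, b ∈ A ∧ a ∉ P b ∧ y ∈ G b := ⟨b, hb, hab, hy⟩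
    simp only [hblk, dif_pos hex]
    have hspec := Classical.choose_spec hex
    have heq : G (Classical.choose hex) = G b :=
      hclass _ hspec.1 b hb hspec.2.1 hab y hspec.2.2 hy
    simp only [heq]
  have hmin_mem : ∀ b (h : (G b).Nonempty), (G b).min' h ∈ G b := fun b h => Finset.min'_mem _ _
  have hg_a : ∀ ω, g a ω ↔ a ∈ ω := by
    intro ω
    constructor
    · intro h; exact h a hblk_a (Or.inl rfl)
    · intro ha e hbe hre
      rcases hre with rfl | ⟨b, hb, hab, heG⟩
      · exact ha
      · exfalso
        rw [hblk_G b hb hab e heG] at hbe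
        exact haG b (hbe ▸ hmin_mem b ⟨e, heG⟩)
  have hg_G : ∀ b ∈ A, a ∉ P b → ∀ (hne : (G b).Nonempty) ω, g ((G b).min' hne) ω ↔ ((G b : Finset (Fin m)) : Set (Fin m)) ⊆ ω := by
    intro b hb hab hne ω
    constructor
    · intro h y hy
      exact h y (hblk_G b hb hab y hy) (Or.inr ⟨b, hb, hab, hy⟩)
    · intro hsub e hbe hre
      rcases hre with rfl | ⟨b', hb', hab', heG'⟩
      · exfalso
        rw [hblk_a] at hbe
        exact haG b (hbe.symm ▸ hmin_mem b hne)
      · rw [hblk_G b' hb' hab' e heG'] at hbe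
        have hr : (G b').min' ⟨e, heG'⟩ ∈ G b := hbe ▸ hmin_mem b hne
        have heq : G b' = G b := hclass b' hb' b hb hab' hab _ (hmin_mem b' ⟨e, heG'⟩) hr
        exact hsub (Finset.mem_coe.2 (heq ▸ heG'))
  have hg_other : ∀ k, k ≠ a → (¬ ∃ b, b ∈ A ∧ a ∉ P b ∧ ∃ hne : (G b).Nonempty, (G b).min' hne = k) → ∀ ω, g k ω := by
    intro k hka hk ω e hbe hre
    exfalso
    rcases hre with rfl | ⟨b, hb, hab, heG⟩
    · exact hka (hblk_a ▸ hbe).symm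
    · rw [hblk_G b hb hab e heG] at hbe
      exact hk ⟨b, hb, hab, ⟨e, heG⟩, hbe⟩
  set q' : Fin m → unitInterval := fun k => ⟨μ.real {ω | g k ω}, measureReal_nonneg, measureReal_le_one⟩ with hq'
  have hq'val : ∀ k, ((q' k : unitInterval) : ℝ) = μ.real {ω | g k ω} := fun k => rfl
  have hq'a : ((q' a : unitInterval) : ℝ) = q a := by
    rw [hq'val]
    have : {ω : Set (Fin m) | g a ω} = {ω | a ∈ ω} := Set.ext fun ω => hg_a ω
    rw [this, hμ, prodBernoulli_real_setOf_mem]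
  have hq'G : ∀ b ∈ A, a ∉ P b → ∀ (hne : (G b).Nonempty),
      ((q' ((G b).min' hne) : unitInterval) : ℝ) = ∏ y ∈ G b, (q y : ℝ) := by
    intro b hb hab hne
    rw [hq'val]
    have : {ω : Set (Fin m) | g ((G b).min' hne) ω} = {ω | ((G b : Finset (Fin m)) : Set (Fin m)) ⊆ ω} :=
      Set.ext fun ω => hg_G b hb hab hne ω
    rw [this, hμ, prodBernoulli_real_subset]
  have hq'other : ∀ k, k ≠ a → (¬ ∃ b, b ∈ A ∧ a ∉ P b ∧ ∃ hne : (G b).Nonempty, (G b).min' hne = k) →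
      ((q' k : unitInterval) : ℝ) = 1 := by
    intro k hka hk
    rw [hq'val]
    have : {ω : Set (Fin m) | g k ω} = Set.univ := Set.eq_univ_of_forall fun ω => hg_other k hka hk ω
    rw [this, probReal_univ]
  have hy : ∀ k, q' a ≤ q' k := by
    intro k
    show ((q' a : unitInterval) : ℝ) ≤ q' k
    rw [hq'a]
    by_cases hka : k = a
    · rw [hka, hq'a]
    by_cases hk : ∃ b, b ∈ A ∧ a ∉ P b ∧ ∃ hne : (G b).Nonempty, (G b).min' hne = k
    · obtain ⟨b, hb, hab, hne, rfl⟩ := hk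
      rw [hq'G b hb hab hne]
      exact hbare b hb hab
    · rw [hq'other k hka hk]; exact hq1 a
  set key : Fin m → Fin m := fun b =>
    if a ∈ P b then a else if hne : (G b).Nonempty then (G b).min' hne else b with hkey
  set c : Fin m → ℝ := fun k => ((A.filter fun b => key b = k).card : ℝ) with hc
  have hc0 : ∀ k, 0 ≤ c k := fun k => by positivity
  have hkey_ge : ∀ b ∈ A, ∏ y ∈ P b, (q y : ℝ) ≤ ((q' (key b) : unitInterval) : ℝ) := by
    intro b hb
    by_cases hab : a ∈ P b
    · simp only [hkey, if_pos hab]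
      rw [hq'a, ← Finset.mul_prod_erase _ _ hab]
      have : ∏ y ∈ (P b).erase a, (q y : ℝ) ≤ 1 := Finset.prod_le_one (fun y _ => hq0 y) fun y _ => hq1 y
      calc (q a : ℝ) * ∏ y ∈ (P b).erase a, (q y : ℝ) ≤ (q a : ℝ) * 1 := mul_le_mul_of_nonneg_left this (hq0 a)
        _ = q a := mul_one _
    · by_cases hne : (G b).Nonempty
      · simp only [hkey, if_neg hab, dif_pos hne]
        rw [hq'G b hb hab hne]
        exact Finset.prod_le_prod_of_subset_of_le_one Finset.sdiff_subset (fun y _ => hq0 y) fun y _ _ => hq1 y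
      · simp only [hkey, if_neg hab, dif_neg hne]
        have hba : b ≠ a := fun h => hab (h ▸ hrefl a)
        have hnk : ¬ ∃ b', b' ∈ A ∧ a ∉ P b' ∧ ∃ hne : (G b').Nonempty, (G b').min' hne = b := by
          rintro ⟨b', hb', hab', hne', hb'eq⟩
          have hbPa : b ∈ P a := by
            by_contra h
            exact hne ⟨b, Finset.mem_sdiff.2 ⟨hrefl b, h⟩⟩
          have hr := hmin_mem b' hne'
          rw [hb'eq] at hr
          exact (Finset.mem_sdiff.1 hr).2 hbPa
        rw [hq'other b hba hnk]
        exact Finset.prod_le_one (fun y _ => hq0 y) fun y _ => hq1 y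
  have hEN' : (2 * (j : ℝ) : ℝ) < ∑ k, c k * ((q' k : unitInterval) : ℝ) := by
    have hsum : ∑ k, c k * ((q' k : unitInterval) : ℝ) = ∑ b ∈ A, ((q' (key b) : unitInterval) : ℝ) := by
      rw [← Finset.sum_fiberwise A key (fun b => ((q' (key b) : unitInterval) : ℝ))]
      refine Finset.sum_congr rfl fun k _ => ?_
      have hin : ∑ b ∈ A with key b = k, ((q' (key b) : unitInterval) : ℝ) =
          ∑ b ∈ A with key b = k, ((q' k : unitInterval) : ℝ) :=
        Finset.sum_congr rfl fun b hb => by rw [(Finset.mem_filter.1 hb).2]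
      rw [hin, Finset.sum_const, nsmul_eq_mul]
    rw [hsum]
    exact lt_of_lt_of_le hEN (Finset.sum_le_sum fun b hb => hkey_ge b hb)
  set S : Set (Set (Fin m)) := {W : Set (Fin m) | ∑ k ∈ (Finset.univ : Finset (Fin m)).filter (fun k => k ∈ W), c k ≤ (j : ℝ)}
    with hS
  have hfar : (prodBernoulli q').real S ≤ 1 - ((q' a : unitInterval) : ℝ) :=
    IndepBlob.prodBernoulli_far_indepBlob q' c hc0 a hy (j : ℝ) hEN'
  have hloc : IsBlockLocal blk g := by
    intro k ω ω' hωω'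
    simp only [hg]
    exact forall_congr' fun e => imp_congr_right fun hbe => imp_congr_right fun _ => hωω' e hbe
  have hmeas : ∀ k, Measurable (g k) := fun k => Measurable.of_discrete
  set R : Set (Fin m) → Set (Fin m) := fun ω => {k | g k ω} with hR
  set S' : Set (Set (Fin m)) :=
    {ω' : Set (Fin m) | ∑ k ∈ (Finset.univ : Finset (Fin m)).filter (fun k => g k ω'), c k ≤ (j : ℝ)} with hS'
  have hSS : R ⁻¹' S = S' := by
    ext ω'
    simp only [Set.mem_preimage, hS, hS', Set.mem_setOf_eq, hR]
  have hpre : μ.real S' = (prodBernoulli q').real S := by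
    rw [← hSS, hμ]
    exact prodBernoulli_real_preimage_readBlocks q blk hloc hmeas q' (fun k => rfl) MeasurableSet.of_discrete
  have hcount : ∀ ω : Set (Fin m), (↑T : Set (Fin m)) ⊆ ω →
      ((A.filter fun b => ((P b : Finset (Fin m)) : Set (Fin m)) ⊆ ω).card : ℝ) =
        ∑ k ∈ (Finset.univ : Finset (Fin m)).filter (fun k => g k ω), c k := by
    intro ω hTω
    have hiff : ∀ b ∈ A, (((P b : Finset (Fin m)) : Set (Fin m)) ⊆ ω ↔ g (key b) ω) := by
      intro b hb
      by_cases hab : a ∈ P b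
      · simp only [hkey, if_pos hab]
        rw [hg_a]
        constructor
        · intro h; exact h (Finset.mem_coe.2 hab)
        · intro ha y hy
          have hy' := Finset.mem_coe.1 hy
          by_cases hya : y = a
          · rw [hya]; exact ha
          · apply hTω
            rw [Finset.mem_coe, hT, Finset.mem_union]
            by_cases hyPa : y ∈ P a
            · exact Or.inl (Finset.mem_erase.2 ⟨hya, hyPa⟩)
            · exact Or.inr (Finset.mem_biUnion.2 ⟨b, Finset.mem_filter.2 ⟨hb, hab⟩, Finset.mem_sdiff.2 ⟨hy', hyPa⟩⟩)
      · by_cases hne : (G b).Nonempty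
        · simp only [hkey, if_neg hab, dif_pos hne]
          rw [hg_G b hb hab hne]
          constructor
          · intro h y hy
            exact h (Finset.mem_coe.2 (Finset.mem_sdiff.1 (Finset.mem_coe.1 hy)).1)
          · intro h y hy
            have hy' := Finset.mem_coe.1 hy
            by_cases hyPa : y ∈ P a
            · have hya : y ≠ a := fun hya => hab (hya ▸ hy')
              exact hTω (Finset.mem_coe.2 (by rw [hT, Finset.mem_union]; exact Or.inl (Finset.mem_erase.2 ⟨hya, hyPa⟩)))
            · exact h (Finset.mem_coe.2 (Finset.mem_sdiff.2 ⟨hy', hyPa⟩))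
        · simp only [hkey, if_neg hab, dif_neg hne]
          have hba : b ≠ a := fun h => hab (h ▸ hrefl a)
          have hbPa : ∀ y ∈ P b, y ∈ P a := by
            intro y hy
            by_contra h
            exact hne ⟨y, Finset.mem_sdiff.2 ⟨hy, h⟩⟩
          have hnk : ¬ ∃ b', b' ∈ A ∧ a ∉ P b' ∧ ∃ hne : (G b').Nonempty, (G b').min' hne = b := by
            rintro ⟨b', hb', hab', hne', hb'eq⟩
            have hr := hmin_mem b' hne'
            rw [hb'eq] at hr
            exact (Finset.mem_sdiff.1 hr).2 (hbPa b (hrefl b))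
          constructor
          · intro _; exact hg_other b hba hnk ω
          · intro _ y hy
            have hy' := Finset.mem_coe.1 hy
            have hya : y ≠ a := fun hya => hab (hya ▸ hy')
            exact hTω (Finset.mem_coe.2 (by rw [hT, Finset.mem_union]; exact Or.inl (Finset.mem_erase.2 ⟨hya, hbPa y hy'⟩)))
    rw [show (A.filter fun b => ((P b : Finset (Fin m)) : Set (Fin m)) ⊆ ω) = A.filter (fun b => g (key b) ω) from
      Finset.filter_congr fun b hb => hiff b hb]
    have hmaps : ((A.filter fun b => g (key b) ω : Finset (Fin m)) : Set (Fin m)).MapsTo key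
        ((Finset.univ : Finset (Fin m)).filter fun k => g k ω) := by
      intro b hb
      have hb' := (Finset.mem_filter.1 (Finset.mem_coe.1 hb)).2
      exact Finset.mem_coe.2 (Finset.mem_filter.2 ⟨Finset.mem_univ _, hb'⟩)
    rw [Finset.card_eq_sum_card_fiberwise hmaps]
    push_cast
    refine Finset.sum_congr rfl fun k hk => ?_
    have hgk : g k ω := (Finset.mem_filter.1 hk).2
    simp only [hc]
    congr 2
    ext b
    simp only [Finset.mem_filter]
    constructor
    · rintro ⟨⟨hb, _⟩, hk⟩; exact ⟨hb, hk⟩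
    · rintro ⟨hb, hk⟩; exact ⟨⟨hb, hk ▸ hgk⟩, hk⟩
  have hevents : {ω : Set (Fin m) | ω ∪ ↑T ∈ L} = {ω : Set (Fin m) | ω ∪ ↑T ∈ S'} := by
    ext ω
    have hc' := hcount (ω ∪ ↑T) Set.subset_union_right
    simp only [Set.mem_setOf_eq, hL, hS']
    rw [← Nat.cast_le (α := ℝ), hc']
  calc μ.real L = μ.real {ω : Set (Fin m) | ω ∪ ↑T ∈ L} := by
          rw [hμ]; exact prodBernoulli_real_eq_union_of_gate_one q T hT1 L
    _ = μ.real {ω : Set (Fin m) | ω ∪ ↑T ∈ S'} := by rw [hevents]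
    _ = μ.real S' := by rw [hμ]; exact (prodBernoulli_real_eq_union_of_gate_one q T hT1 _).symm
    _ = (prodBernoulli q').real S := hpre
    _ ≤ 1 - ((q' a : unitInterval) : ℝ) := hfar
    _ = 1 - (q a : ℝ) := by rw [hq'a]

/-- **Induction over the chain** (on the number `n` of non-sure strict members of `P a`): the block-comb hypotheses and the mean hypothesis give
`P(#{b ∈ A | P b open} ≤ j) ≤ 1 − ∏_{P a} q`.  Step: a non-sure `e ∈ P a ∖ {a}` with `q e = 0` makes the bound `1`; otherwise
`Quant.farTree_light_le_of_contract` reduces to `q[e ↦ 1]`, where every hypothesis persists. [this work] -/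
theorem farTree_blockComb_bareLeaf_aux (P : Fin m → Finset (Fin m)) (hrefl : ∀ x, x ∈ P x)
    (A : Finset (Fin m)) (j : ℕ) (a : Fin m) (haA : a ∈ A)
    (hshape : ∀ b ∈ A, ∀ b' ∈ A, a ∉ P b → a ∉ P b' →
      P b \ P a = P b' \ P a ∨ Disjoint (P b \ P a) (P b' \ P a)) :
    ∀ (n : ℕ) (q : Fin m → unitInterval),
      (((P a).erase a).filter fun y => q y ≠ 1).card = n →
      (∀ b ∈ A, a ∈ P b → ∀ y ∈ P b, y ∉ P a → q y = 1) →
      (∀ b ∈ A, a ∉ P b → (q a : ℝ) ≤ ∏ y ∈ P b \ P a, (q y : ℝ)) →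
      (2 * j : ℝ) < ∑ b ∈ A, ∏ y ∈ P b, (q y : ℝ) →
      (prodBernoulli q).real
          {ω : Set (Fin m) | (A.filter fun b => ((P b : Finset (Fin m)) : Set (Fin m)) ⊆ ω).card ≤ j} ≤
        1 - ∏ y ∈ P a, (q y : ℝ) := by
  intro n
  induction n with
  | zero =>
    intro q hn hglue hbare hEN
    have hchain : ∀ y ∈ P a, y ≠ a → q y = 1 := by
      intro y hy hya
      by_contra hq
      have : y ∈ ((P a).erase a).filter fun y => q y ≠ 1 := Finset.mem_filter.2 ⟨Finset.mem_erase.2 ⟨hya, hy⟩, hq⟩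
      rw [Finset.card_eq_zero.1 hn] at this
      exact Finset.notMem_empty _ this
    have hprod : ∏ y ∈ P a, (q y : ℝ) = q a := by
      rw [← Finset.mul_prod_erase _ _ (hrefl a)]
      rw [Finset.prod_eq_one fun y hy => by
        rw [hchain y (Finset.mem_of_mem_erase hy) (Finset.ne_of_mem_erase hy)]; rfl]
      exact mul_one _
    rw [hprod]
    exact farTree_blockComb_bareLeaf_base P hrefl q A j a haA hchain hglue hshape hbare hEN
  | succ n ih =>
    intro q hn hglue hbare hEN
    have hne : (((P a).erase a).filter fun y => q y ≠ 1).Nonempty := by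
      rw [← Finset.card_pos, hn]; exact Nat.succ_pos n
    obtain ⟨e, he⟩ := hne
    have heP : e ∈ P a := Finset.mem_of_mem_erase (Finset.mem_filter.1 he).1
    have hea : e ≠ a := Finset.ne_of_mem_erase (Finset.mem_filter.1 he).1
    have hqe1 : q e ≠ 1 := (Finset.mem_filter.1 he).2
    by_cases hqe0 : (q e : ℝ) = 0
    · -- the chain is closed with probability one at `e`: the bound is `1`
      have hprod : ∏ y ∈ P a, (q y : ℝ) = 0 := Finset.prod_eq_zero heP hqe0
      rw [hprod, sub_zero]
      exact measureReal_le_one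
    set q' : Fin m → unitInterval := Function.update q e 1 with hq'
    have hq'e : q' e = 1 := by simp [hq']
    have hq'ne : ∀ y, y ≠ e → q' y = q y := fun y hy => by simp [hq', Function.update_of_ne hy]
    have hn' : (((P a).erase a).filter fun y => q' y ≠ 1).card = n := by
      have hset : (((P a).erase a).filter fun y => q' y ≠ 1) = (((P a).erase a).filter fun y => q y ≠ 1).erase e := by
        ext y
        simp only [Finset.mem_filter, Finset.mem_erase]
        constructor
        · rintro ⟨hy, hq⟩
          have hye : y ≠ e := fun h => hq (h ▸ hq'e)
          exact ⟨hye, hy, by rwa [hq'ne y hye] at hq⟩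
        · rintro ⟨hye, hy, hq⟩
          exact ⟨hy, by rwa [hq'ne y hye]⟩
      rw [hset, Finset.card_erase_of_mem he, hn]
      rfl
    have hglue' : ∀ b ∈ A, a ∈ P b → ∀ y ∈ P b, y ∉ P a → q' y = 1 := by
      intro b hb hab y hy hyPa
      have hye : y ≠ e := fun h => hyPa (h ▸ heP)
      rw [hq'ne y hye]
      exact hglue b hb hab y hy hyPa
    have hbare' : ∀ b ∈ A, a ∉ P b → (q' a : ℝ) ≤ ∏ y ∈ P b \ P a, (q' y : ℝ) := by
      intro b hb hab
      rw [hq'ne a hea.symm]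
      have : ∏ y ∈ P b \ P a, (q' y : ℝ) = ∏ y ∈ P b \ P a, (q y : ℝ) :=
        Finset.prod_congr rfl fun y hy => by
          rw [hq'ne y (fun h => (Finset.mem_sdiff.1 hy).2 (h ▸ heP))]
      rw [this]
      exact hbare b hb hab
    have hEN' : (2 * j : ℝ) < ∑ b ∈ A, ∏ y ∈ P b, (q' y : ℝ) :=
      lt_of_lt_of_le hEN (Finset.sum_le_sum fun b _ => prod_le_prod_update_one q e (P b))
    have hih := ih q' hn' hglue' hbare' hEN'
    have hkey := prod_update_one_eq q e (P a)
    rw [if_pos heP] at hkey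
    have hqe_pos : 0 < (q e : ℝ) := lt_of_le_of_ne (q e).2.1 (Ne.symm hqe0)
    have hdiv : ∏ y ∈ P a, (q' y : ℝ) = (∏ y ∈ P a, (q y : ℝ)) / (q e : ℝ) := by
      rw [eq_div_iff hqe0, hq']
      exact hkey
    rw [hdiv] at hih
    exact farTree_light_le_of_contract P q A j (∏ y ∈ P a, (q y : ℝ)) e hqe0 hih

/-- **FAR at EVERY layer for block-combs in the bare-leaf cell** (gate coordinates of `Quant.FarTreeRow`): gate sets `P x ∋ x` on `Fin m`,
gates `q`, relays `A ∋ a`, layer `j`; (glue) relays `b` with `a ∈ P b` have `P b ∖ P a` sure; (block-comb) for `b, b'` with `a ∉ P b, P b'` the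
private parts `P b ∖ P a`, `P b' ∖ P a` are equal or disjoint; (bare leaf) `q a ≤ ∏_{P b ∖ P a} q` whenever `a ∉ P b`.  Then
`2j < Σ_{b∈A} ∏_{P b} q` and `1 − ∏_{P a} q ≤ t` give `P(#{b ∈ A | P b open} ≤ j) ≤ t`.  Contains block-stars, the 'blocks heavier than the bare
leaf' cell of hub + leaves + root blocks, and — new — root blocks + combs of any depth and blob hairs at any level, in this cell.
builds on p205010 (kernel theorem, internal audit signed; external expert review pending). [this work] -/
theorem farTree_blockComb_bareLeaf (P : Fin m → Finset (Fin m)) (hrefl : ∀ x, x ∈ P x)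
    (q : Fin m → unitInterval) (A : Finset (Fin m)) (j : ℕ) (t : ℝ) (a : Fin m) (haA : a ∈ A)
    (hglue : ∀ b ∈ A, a ∈ P b → ∀ y ∈ P b, y ∉ P a → q y = 1)
    (hshape : ∀ b ∈ A, ∀ b' ∈ A, a ∉ P b → a ∉ P b' →
      P b \ P a = P b' \ P a ∨ Disjoint (P b \ P a) (P b' \ P a))
    (hbare : ∀ b ∈ A, a ∉ P b → (q a : ℝ) ≤ ∏ y ∈ P b \ P a, (q y : ℝ))
    (hEN : (2 * j : ℝ) < ∑ b ∈ A, ∏ y ∈ P b, (q y : ℝ))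
    (ht : 1 - ∏ y ∈ P a, (q y : ℝ) ≤ t) :
    (prodBernoulli q).real
        {ω : Set (Fin m) | (A.filter fun b => ((P b : Finset (Fin m)) : Set (Fin m)) ⊆ ω).card ≤ j} ≤ t :=
  le_trans (farTree_blockComb_bareLeaf_aux P hrefl A j a haA hshape _ q rfl hglue hbare hEN) ht

end Quant
end Summit.CriticalPhenomena.PercolationContinuityZ3.Theorems
end
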